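import Summits.AtomisticToContinuum.HydrodynamicLimit.Theorems.ImplosionDichotomyHydroLimitInBandWindowBalance
import Summits.AtomisticToContinuum.HydrodynamicLimit.Theorems.OneFlightGossipEngineClampedCurrentsDockPathwise
import Summits.AtomisticToContinuum.HydrodynamicLimit.Theorems.BoltzmannGreenKubo.Negative.JointMeasurability
import HarnessLib

/-!
# Window continuity of the relative-entropy ledger, in band — the streaming term in expectation
(helper of stub `stub_windowContinuityInBand`, line `IdeatorOneSketch`, crux `HydroLimitInBand`,
stmt-AtomisticToContinuum-9133)

Support file (`--supports stmt-AtomisticToContinuum-9133`). The kinetic side of the crude short-time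
continuity of `H_N(s) = KL(f_s ‖ ψ_s)`: once the streaming rate of the unit-activity exponent obeys the cubic
bound `|Dg¹_r(x, v)| ≤ K (1 + |v|³)` on `[0, t₁]` (the companion file `…WindowContinuityFields`), the streaming
integral of the sibling dock's pathwise balance `ClampedCurrentsDockPathwise.gSum_sub_eq` over a window
`[s, s'] ⊆ [0, t₁]` is bounded pathwise by `∫_s^{s'} K Σ_i (1 + |v_i(r)|³) dr` (`abs_integral_DgSum_le`; along a
good orbit the velocities are measurable in time — the flow modified off the good set is jointly measurable,
`BoltzmannGreenKuboOrthMomentum.measurable_flowMod` — and bounded by the conserved energy), and IN MEAN under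
the local Gibbs law by `(s' − s) K (N+1) (2 + M₊ C)` (`lintegral_streamingBound_le`): Tonelli in `(r, z)`, then
at each fixed time `|v|³ ≤ M₊ |v|² + 𝟙{M < |v|} |v|³`, conservation of `Σ_i |v_i|²` (mean `≤ (N+1) C` at time `0`)
and the cubic-tail input `EnergyCurrentTails` at ONE fixed level (`E[(N+1)⁻¹ Σ_i 𝟙{M < |v_i(r)|}|v_i(r)|³] ≤ 1`
for `r ∈ [0, t₁]`).

References: H.-T. Yau, Lett. Math. Phys. 22 (1991) §2; H. Spohn, *Large Scale Dynamics of Interacting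
Particles* (1991), Part I §3.2.
-/

noncomputable section

open MeasureTheory Filter Set Topology
open scoped ENNReal

namespace Summit.AtomisticToContinuum.HydrodynamicLimit.Theorems.HydroLimitInBandContinuity

open Literature.MathematicalPhysics.KineticTheory Literature.Analysis.FluidPDE
open Literature.Analysis.FunctionSpaces
open Summit.AtomisticToContinuum.HydrodynamicLimit.Theorems.ClampedCurrentsDockPathwise (DgExp DgSum)
open Summit.AtomisticToContinuum.HydrodynamicLimit.Theorems.BoltzmannGreenKuboOrthMomentum
  (flowMod measurable_flowMod flowMod_of_mem)
open Summit.AtomisticToContinuum.HydrodynamicLimit.Theorems.EntropyClockDock (ae_mem_good_localGibbsLaw)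

variable {σ : ℝ} {N : ℕ}

/-! ### §1 Along a good orbit: measurability in time and the energy bound -/

/-- A good orbit is measurable in time (the flow modified off the good set is jointly measurable).
[folklore] -/
theorem measurable_flow_of_mem (Φ : HardSphereFlow (Torus.geometry (Fin 3)) (hsDiameter σ N) (N + 1))
    {z : Config (N + 1) (Fin 3) T3} (hz : z ∈ Φ.good) : Measurable fun r => Φ.flow r z := by
  have h : (fun r => Φ.flow r z) = fun r : ℝ => flowMod Φ (r, z) :=
    funext fun r => (flowMod_of_mem Φ hz).symm
  rw [h]
  exact (measurable_flowMod Φ).comp (measurable_id.prodMk measurable_const)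

/-- Along a good orbit every velocity is bounded by the conserved kinetic energy: `|v_i(r)|² ≤ 2 E(z)`.
[folklore] -/
theorem norm_vel_flow_sq_le (Φ : HardSphereFlow (Torus.geometry (Fin 3)) (hsDiameter σ N) (N + 1))
    {z : Config (N + 1) (Fin 3) T3} (hz : z ∈ Φ.good) (r : ℝ) (i : Fin (N + 1)) :
    ‖(Φ.flow r z i).2‖ ^ 2 ≤ 2 * configEnergy z := by
  have hE : configEnergy (Φ.flow r z) = configEnergy z := by
    have h := IsHardSphereTrajectory.configEnergy_eq_holds (Φ.isTrajectory z hz) r 0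
    rwa [Φ.flow_zero z hz] at h
  have h1 : ‖(Φ.flow r z i).2‖ ^ 2 ≤ ∑ j, ‖(Φ.flow r z j).2‖ ^ 2 :=
    Finset.single_le_sum (fun j _ => sq_nonneg ‖(Φ.flow r z j).2‖) (Finset.mem_univ i)
  have h2 : ∑ j, ‖(Φ.flow r z j).2‖ ^ 2 = 2 * configEnergy z := by
    rw [← hE, configEnergy]
    ring
  linarith

/-- Conservation of `Σ_i |v_i|²` along a good orbit. [folklore] -/
theorem sum_norm_vel_flow_sq_eq (Φ : HardSphereFlow (Torus.geometry (Fin 3)) (hsDiameter σ N) (N + 1))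
    {z : Config (N + 1) (Fin 3) T3} (hz : z ∈ Φ.good) (r : ℝ) :
    ∑ i, ‖(Φ.flow r z i).2‖ ^ 2 = ∑ i, ‖(z i).2‖ ^ 2 := by
  have h := IsHardSphereTrajectory.configEnergy_eq_holds (Φ.isTrajectory z hz) r 0
  rw [Φ.flow_zero z hz] at h
  have h2 : (2 : ℝ) * configEnergy (Φ.flow r z) = 2 * configEnergy z := by rw [h]
  simpa [configEnergy] using h2

/-- The cubic velocity sum `r ↦ K Σ_i (1 + |v_i(r)|³)` is integrable on every bounded window along a good
orbit (measurable in time and bounded by the conserved energy). [folklore] -/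
theorem integrableOn_cubicSum (Φ : HardSphereFlow (Torus.geometry (Fin 3)) (hsDiameter σ N) (N + 1))
    {z : Config (N + 1) (Fin 3) T3} (hz : z ∈ Φ.good) (K s s' : ℝ) :
    IntegrableOn (fun r => K * ∑ i, (1 + ‖(Φ.flow r z i).2‖ ^ 3)) (Ioc s s') := by
  have hm : Measurable fun r => K * ∑ i, (1 + ‖(Φ.flow r z i).2‖ ^ 3) := by
    refine measurable_const.mul (Finset.measurable_sum _ fun i _ => measurable_const.add ?_)
    exact (((measurable_pi_apply i).comp (measurable_flow_of_mem Φ hz)).snd.norm.pow_const 3)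
  refine IntegrableOn.of_bound measure_Ioc_lt_top hm.aestronglyMeasurable
    (|K| * ∑ _i : Fin (N + 1), (1 + (1 + 2 * configEnergy z) * (2 * configEnergy z)))
    (ae_of_all _ fun r => ?_)
  rw [Real.norm_eq_abs, abs_mul]
  refine mul_le_mul_of_nonneg_left ?_ (abs_nonneg _)
  rw [abs_of_nonneg (Finset.sum_nonneg fun i _ => by positivity)]
  refine Finset.sum_le_sum fun i _ => add_le_add le_rfl ?_
  have he := norm_vel_flow_sq_le Φ hz r i
  have hn := norm_nonneg (Φ.flow r z i).2
  have h1 : ‖(Φ.flow r z i).2‖ ≤ 1 + 2 * configEnergy z := by nlinarith [sq_nonneg (‖(Φ.flow r z i).2‖ - 1)]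
  calc ‖(Φ.flow r z i).2‖ ^ 3 = ‖(Φ.flow r z i).2‖ * ‖(Φ.flow r z i).2‖ ^ 2 := by ring
    _ ≤ (1 + 2 * configEnergy z) * (2 * configEnergy z) := mul_le_mul h1 he (sq_nonneg _) (by linarith)

/-! ### §2 The streaming integral: pathwise bound -/

/-- **Pathwise bound on the streaming integral.** If `|Dg¹_r(x, v)| ≤ K (1 + |v|³)` for `r ∈ [0, t₁]`, then along
a good orbit and for a window `[s, s'] ⊆ [0, t₁]`,
`|∫_s^{s'} Σ_i Dg¹_r(z_i(r)) dr| ≤ ∫_s^{s'} K Σ_i (1 + |v_i(r)|³) dr`. [cite: Yau1991, §2] -/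
theorem abs_integral_DgSum_le (Φ : HardSphereFlow (Torus.geometry (Fin 3)) (hsDiameter σ N) (N + 1))
    {T : ℝ} {θ : ℝ → T3 → ℝ} {u : ℝ → T3 → V3} {K t₁ : ℝ}
    (hK : ∀ r ∈ Icc 0 t₁, ∀ y : T3 × V3, |DgExp T (fun _ _ => (1 : ℝ)) θ u r y| ≤ K * (1 + ‖y.2‖ ^ 3))
    {z : Config (N + 1) (Fin 3) T3} (hz : z ∈ Φ.good) {s s' : ℝ} (hs : 0 ≤ s) (hss' : s ≤ s')
    (hs't : s' ≤ t₁) :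
    |∫ r in s..s', DgSum T (fun _ _ => (1 : ℝ)) θ u r (Φ.flow r z)| ≤
      ∫ r in s..s', K * ∑ i, (1 + ‖(Φ.flow r z i).2‖ ^ 3) := by
  have hint : IntervalIntegrable (fun r => K * ∑ i, (1 + ‖(Φ.flow r z i).2‖ ^ 3)) volume s s' :=
    (intervalIntegrable_iff_integrableOn_Ioc_of_le hss').2 (integrableOn_cubicSum Φ hz K s s')
  have h := intervalIntegral.norm_integral_le_of_norm_le hss'
    (f := fun r => DgSum T (fun _ _ => (1 : ℝ)) θ u r (Φ.flow r z))
    (g := fun r => K * ∑ i, (1 + ‖(Φ.flow r z i).2‖ ^ 3)) (ae_of_all _ fun r hr => ?_) hint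
  · simpa only [Real.norm_eq_abs] using h
  · have hr' : r ∈ Icc 0 t₁ := ⟨hs.trans hr.1.le, hr.2.trans hs't⟩
    rw [Real.norm_eq_abs, DgSum, Finset.mul_sum]
    exact (Finset.abs_sum_le_sum_abs _ _).trans (Finset.sum_le_sum fun i _ => hK r hr' _)

/-! ### §3 The streaming bound in mean: Tonelli, energy conservation and the cubic tails -/

/-- `|v|³ ≤ M₊ |v|² + 𝟙{M < |v|} |v|³`. [folklore] -/
theorem norm_cube_le_indicator (M : ℝ) (v : V3) :
    ‖v‖ ^ 3 ≤ max M 0 * ‖v‖ ^ 2 + Set.indicator {w : V3 | M < ‖w‖} (fun w => ‖w‖ ^ 3) v := by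
  by_cases h : M < ‖v‖
  · rw [indicator_of_mem (show v ∈ {w : V3 | M < ‖w‖} from h)]
    nlinarith [le_max_right M 0, sq_nonneg ‖v‖]
  · rw [indicator_of_notMem (show v ∉ {w : V3 | M < ‖w‖} from h), add_zero]
    calc ‖v‖ ^ 3 = ‖v‖ * ‖v‖ ^ 2 := by ring
      _ ≤ max M 0 * ‖v‖ ^ 2 :=
          mul_le_mul_of_nonneg_right ((not_lt.1 h).trans (le_max_left M 0)) (sq_nonneg _)

variable {a₀ θ₀ : T3 → ℝ} {u₀ : T3 → V3}

/-- **The cubic velocity sum at a fixed time, in mean.** Under `λ_N = localGibbsLaw σ a₀ u₀ θ₀ N Φ`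
(`σ ≤ 1/2`, continuous positive profiles), if `E[(N+1)⁻¹ Σ_i |v_i|²] ≤ C` at time `0` and the cubic tail at
time `r` satisfies `E[(N+1)⁻¹ Σ_i 𝟙{M < |v_i(r)|} |v_i(r)|³] ≤ 1`, then
`E[K Σ_i (1 + |v_i(r)|³)] ≤ K (N+1) (2 + M₊ C)` (energy conservation along the flow). [cite: Yau1991, §2] -/
theorem lintegral_cubicSum_le (hσ2 : σ ≤ 1 / 2) (ha : Continuous a₀) (hθ : Continuous θ₀)
    (hu : Continuous u₀) (ha0 : ∀ x, 0 < a₀ x) (hθ0 : ∀ x, 0 < θ₀ x)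
    (Φ : HardSphereFlow (Torus.geometry (Fin 3)) (hsDiameter σ N) (N + 1)) {K C M : ℝ} (hK0 : 0 ≤ K)
    (hC0 : 0 ≤ C)
    (hKE : ∫⁻ z, ENNReal.ofReal (((N : ℝ) + 1)⁻¹ * ∑ i, ‖(z i).2‖ ^ 2) ∂(localGibbsLaw σ a₀ u₀ θ₀ N Φ) ≤
      ENNReal.ofReal C)
    {r : ℝ} (hECT : ∫⁻ z, ENNReal.ofReal (((N : ℝ) + 1)⁻¹ * ∑ i : Fin (N + 1),
      Set.indicator {v : V3 | M < ‖v‖} (fun v => ‖v‖ ^ 3) ((Φ.flow r z i).2)) ∂(localGibbsLaw σ a₀ u₀ θ₀ N Φ) ≤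
      ENNReal.ofReal 1) :
    ∫⁻ z, ENNReal.ofReal (K * ∑ i, (1 + ‖(Φ.flow r z i).2‖ ^ 3)) ∂(localGibbsLaw σ a₀ u₀ θ₀ N Φ) ≤
      ENNReal.ofReal (K * ((N : ℝ) + 1) * (2 + max M 0 * C)) := by
  haveI := isProbabilityMeasure_localGibbsLaw ha hθ hu ha0 hθ0 hσ2 N Φ
  have hN : (0 : ℝ) < (N : ℝ) + 1 := by positivity
  have hM0 : 0 ≤ max M 0 := le_max_right _ _
  set f₁ : Config (N + 1) (Fin 3) T3 → ℝ≥0∞ := fun z =>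
    ENNReal.ofReal (((N : ℝ) + 1)⁻¹ * ∑ i, ‖(Φ.flow r z i).2‖ ^ 2) with hf₁
  set f₂ : Config (N + 1) (Fin 3) T3 → ℝ≥0∞ := fun z => ENNReal.ofReal (((N : ℝ) + 1)⁻¹ * ∑ i : Fin (N + 1),
    Set.indicator {v : V3 | M < ‖v‖} (fun v => ‖v‖ ^ 3) ((Φ.flow r z i).2)) with hf₂
  have hf₁m : Measurable f₁ := by
    refine (measurable_const.mul (Finset.measurable_sum _ fun i _ => ?_)).ennreal_ofReal
    exact ((measurable_pi_apply i).comp (Φ.measurable_flow r)).snd.norm.pow_const 2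
  -- pointwise splitting of the cubic sum
  have hpt : ∀ z, ENNReal.ofReal (K * ∑ i, (1 + ‖(Φ.flow r z i).2‖ ^ 3)) ≤
      ENNReal.ofReal (K * ((N : ℝ) + 1)) + ENNReal.ofReal (K * max M 0 * ((N : ℝ) + 1)) * f₁ z +
        ENNReal.ofReal (K * ((N : ℝ) + 1)) * f₂ z := by
    intro z
    have hI0 : ∀ i, 0 ≤ Set.indicator {v : V3 | M < ‖v‖} (fun v => ‖v‖ ^ 3) ((Φ.flow r z i).2) := fun i =>
      Set.indicator_nonneg (fun v _ => by positivity) _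
    rw [hf₁, hf₂, ← ENNReal.ofReal_mul (by positivity), ← ENNReal.ofReal_mul (by positivity),
      ← ENNReal.ofReal_add (by positivity) (by positivity),
      ← ENNReal.ofReal_add (by positivity) (mul_nonneg (by positivity)
        (mul_nonneg (inv_nonneg.2 hN.le) (Finset.sum_nonneg fun i _ => hI0 i)))]
    refine ENNReal.ofReal_le_ofReal ?_
    have hsum : ∑ i, (1 + ‖(Φ.flow r z i).2‖ ^ 3) ≤ ((N : ℝ) + 1) +
        max M 0 * ∑ i, ‖(Φ.flow r z i).2‖ ^ 2 +
        ∑ i, Set.indicator {v : V3 | M < ‖v‖} (fun v => ‖v‖ ^ 3) ((Φ.flow r z i).2) := by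
      calc ∑ i, (1 + ‖(Φ.flow r z i).2‖ ^ 3)
          ≤ ∑ i, (1 + (max M 0 * ‖(Φ.flow r z i).2‖ ^ 2 +
              Set.indicator {v : V3 | M < ‖v‖} (fun v => ‖v‖ ^ 3) ((Φ.flow r z i).2))) :=
            Finset.sum_le_sum fun i _ => add_le_add le_rfl (norm_cube_le_indicator M _)
        _ = ((N : ℝ) + 1) + max M 0 * ∑ i, ‖(Φ.flow r z i).2‖ ^ 2 +
              ∑ i, Set.indicator {v : V3 | M < ‖v‖} (fun v => ‖v‖ ^ 3) ((Φ.flow r z i).2) := by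
            rw [Finset.sum_add_distrib, Finset.sum_add_distrib, Finset.sum_const, Finset.card_univ,
              Fintype.card_fin, nsmul_eq_mul, mul_one, Finset.mul_sum]
            push_cast
            ring
    calc K * ∑ i, (1 + ‖(Φ.flow r z i).2‖ ^ 3)
        ≤ K * (((N : ℝ) + 1) + max M 0 * ∑ i, ‖(Φ.flow r z i).2‖ ^ 2 +
            ∑ i, Set.indicator {v : V3 | M < ‖v‖} (fun v => ‖v‖ ^ 3) ((Φ.flow r z i).2)) :=
          mul_le_mul_of_nonneg_left hsum hK0
      _ = K * ((N : ℝ) + 1) + K * max M 0 * ((N : ℝ) + 1) * (((N : ℝ) + 1)⁻¹ * ∑ i, ‖(Φ.flow r z i).2‖ ^ 2) +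
            K * ((N : ℝ) + 1) * (((N : ℝ) + 1)⁻¹ *
              ∑ i, Set.indicator {v : V3 | M < ‖v‖} (fun v => ‖v‖ ^ 3) ((Φ.flow r z i).2)) := by
          field_simp
  -- the second moment is conserved along the flow
  have hKE' : ∫⁻ z, f₁ z ∂(localGibbsLaw σ a₀ u₀ θ₀ N Φ) ≤ ENNReal.ofReal C := by
    refine le_of_eq_of_le (lintegral_congr_ae ?_) hKE
    filter_upwards [ae_mem_good_localGibbsLaw σ a₀ θ₀ u₀ N Φ] with z hz
    simp only [hf₁]
    rw [sum_norm_vel_flow_sq_eq Φ hz r]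
  calc ∫⁻ z, ENNReal.ofReal (K * ∑ i, (1 + ‖(Φ.flow r z i).2‖ ^ 3)) ∂(localGibbsLaw σ a₀ u₀ θ₀ N Φ)
      ≤ ∫⁻ z, (ENNReal.ofReal (K * ((N : ℝ) + 1)) + ENNReal.ofReal (K * max M 0 * ((N : ℝ) + 1)) * f₁ z +
          ENNReal.ofReal (K * ((N : ℝ) + 1)) * f₂ z) ∂(localGibbsLaw σ a₀ u₀ θ₀ N Φ) := lintegral_mono hpt
    _ = ENNReal.ofReal (K * ((N : ℝ) + 1)) +
          ENNReal.ofReal (K * max M 0 * ((N : ℝ) + 1)) * ∫⁻ z, f₁ z ∂(localGibbsLaw σ a₀ u₀ θ₀ N Φ) +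
          ENNReal.ofReal (K * ((N : ℝ) + 1)) * ∫⁻ z, f₂ z ∂(localGibbsLaw σ a₀ u₀ θ₀ N Φ) := by
        have hm12 : Measurable fun z => ENNReal.ofReal (K * ((N : ℝ) + 1)) +
            ENNReal.ofReal (K * max M 0 * ((N : ℝ) + 1)) * f₁ z := measurable_const.add (measurable_const.mul hf₁m)
        have e1 : ∫⁻ z, (ENNReal.ofReal (K * ((N : ℝ) + 1)) + ENNReal.ofReal (K * max M 0 * ((N : ℝ) + 1)) * f₁ z +
            ENNReal.ofReal (K * ((N : ℝ) + 1)) * f₂ z) ∂(localGibbsLaw σ a₀ u₀ θ₀ N Φ) =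
            (∫⁻ z, (ENNReal.ofReal (K * ((N : ℝ) + 1)) + ENNReal.ofReal (K * max M 0 * ((N : ℝ) + 1)) * f₁ z)
              ∂(localGibbsLaw σ a₀ u₀ θ₀ N Φ)) +
            ∫⁻ z, ENNReal.ofReal (K * ((N : ℝ) + 1)) * f₂ z ∂(localGibbsLaw σ a₀ u₀ θ₀ N Φ) :=
          lintegral_add_left hm12 _
        have e2 : ∫⁻ z, (ENNReal.ofReal (K * ((N : ℝ) + 1)) + ENNReal.ofReal (K * max M 0 * ((N : ℝ) + 1)) * f₁ z)
              ∂(localGibbsLaw σ a₀ u₀ θ₀ N Φ) =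
            (∫⁻ _z, ENNReal.ofReal (K * ((N : ℝ) + 1)) ∂(localGibbsLaw σ a₀ u₀ θ₀ N Φ)) +
            ∫⁻ z, ENNReal.ofReal (K * max M 0 * ((N : ℝ) + 1)) * f₁ z ∂(localGibbsLaw σ a₀ u₀ θ₀ N Φ) :=
          lintegral_add_left measurable_const _
        rw [e1, e2, lintegral_const, measure_univ, mul_one, lintegral_const_mul _ hf₁m,
          lintegral_const_mul' _ _ ENNReal.ofReal_ne_top]
    _ ≤ ENNReal.ofReal (K * ((N : ℝ) + 1)) + ENNReal.ofReal (K * max M 0 * ((N : ℝ) + 1)) * ENNReal.ofReal C +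
          ENNReal.ofReal (K * ((N : ℝ) + 1)) * ENNReal.ofReal 1 := by
        gcongr
    _ = ENNReal.ofReal (K * ((N : ℝ) + 1) * (2 + max M 0 * C)) := by
        rw [← ENNReal.ofReal_mul (by positivity), ← ENNReal.ofReal_mul (by positivity),
          ← ENNReal.ofReal_add (by positivity) (by positivity),
          ← ENNReal.ofReal_add (by positivity) (by positivity)]
        congr 1
        ring

/-- **The streaming bound in mean.** Under `λ_N` (`σ ≤ 1/2`, continuous positive profiles), for `K ≥ 0`, a
window `[s, s'] ⊆ [0, t₁]`, a second-moment bound `E[(N+1)⁻¹ Σ_i |v_i|²] ≤ C` at time `0` and the cubic tails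
`E[(N+1)⁻¹ Σ_i 𝟙{M < |v_i(r)|} |v_i(r)|³] ≤ 1` at all `r ∈ [0, t₁]`:
`E[∫_s^{s'} K Σ_i (1 + |v_i(r)|³) dr] ≤ (s' − s) K (N+1) (2 + M₊ C)` (Tonelli through the jointly measurable
modified flow, and `lintegral_cubicSum_le` at each time). [cite: Yau1991, §2] -/
theorem lintegral_streamingBound_le (hσ2 : σ ≤ 1 / 2) (ha : Continuous a₀) (hθ : Continuous θ₀)
    (hu : Continuous u₀) (ha0 : ∀ x, 0 < a₀ x) (hθ0 : ∀ x, 0 < θ₀ x)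
    (Φ : HardSphereFlow (Torus.geometry (Fin 3)) (hsDiameter σ N) (N + 1)) {K C M : ℝ} (hK0 : 0 ≤ K)
    (hC0 : 0 ≤ C) {s s' t₁ : ℝ} (hs : 0 ≤ s) (hss' : s ≤ s') (hs't : s' ≤ t₁)
    (hKE : ∫⁻ z, ENNReal.ofReal (((N : ℝ) + 1)⁻¹ * ∑ i, ‖(z i).2‖ ^ 2) ∂(localGibbsLaw σ a₀ u₀ θ₀ N Φ) ≤
      ENNReal.ofReal C)
    (hECT : ∀ r ∈ Icc 0 t₁, ∫⁻ z, ENNReal.ofReal (((N : ℝ) + 1)⁻¹ * ∑ i : Fin (N + 1),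
      Set.indicator {v : V3 | M < ‖v‖} (fun v => ‖v‖ ^ 3) ((Φ.flow r z i).2)) ∂(localGibbsLaw σ a₀ u₀ θ₀ N Φ) ≤
      ENNReal.ofReal 1) :
    ∫⁻ z, ENNReal.ofReal (∫ r in s..s', K * ∑ i, (1 + ‖(Φ.flow r z i).2‖ ^ 3)) ∂(localGibbsLaw σ a₀ u₀ θ₀ N Φ) ≤
      ENNReal.ofReal ((s' - s) * (K * ((N : ℝ) + 1) * (2 + max M 0 * C))) := by
  haveI := isProbabilityMeasure_localGibbsLaw ha hθ hu ha0 hθ0 hσ2 N Φ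
  -- the jointly measurable integrand through the modified flow
  set F : Config (N + 1) (Fin 3) T3 × ℝ → ℝ≥0∞ := fun p =>
    ENNReal.ofReal (K * ∑ i, (1 + ‖(flowMod Φ (p.2, p.1) i).2‖ ^ 3)) with hF
  have hFm : Measurable F := by
    refine (measurable_const.mul (Finset.measurable_sum _ fun i _ => measurable_const.add ?_)).ennreal_ofReal
    exact (((measurable_pi_apply i).comp ((measurable_flowMod Φ).comp
      (measurable_snd.prodMk measurable_fst))).snd.norm.pow_const 3)
  have hgood := ae_mem_good_localGibbsLaw σ a₀ θ₀ u₀ N Φ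
  -- (1) the inner time integral as a lower integral of `F`
  have h1 : ∀ᵐ z ∂(localGibbsLaw σ a₀ u₀ θ₀ N Φ),
      ENNReal.ofReal (∫ r in s..s', K * ∑ i, (1 + ‖(Φ.flow r z i).2‖ ^ 3)) =
        ∫⁻ r in Ioc s s', F (z, r) := by
    filter_upwards [hgood] with z hz
    rw [intervalIntegral.integral_of_le hss',
      ofReal_integral_eq_lintegral_ofReal (integrableOn_cubicSum Φ hz K s s')
        (ae_of_all _ fun r => mul_nonneg hK0 (Finset.sum_nonneg fun i _ => by positivity))]
    refine lintegral_congr fun r => ?_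
    simp only [hF, flowMod_of_mem Φ hz]
  -- (2) Tonelli
  have h2 : ∫⁻ z, (∫⁻ r in Ioc s s', F (z, r)) ∂(localGibbsLaw σ a₀ u₀ θ₀ N Φ) =
      ∫⁻ r in Ioc s s', ∫⁻ z, F (z, r) ∂(localGibbsLaw σ a₀ u₀ θ₀ N Φ) :=
    lintegral_lintegral_swap hFm.aemeasurable
  -- (3) at each time of the window
  have h3 : ∀ r ∈ Ioc s s', ∫⁻ z, F (z, r) ∂(localGibbsLaw σ a₀ u₀ θ₀ N Φ) ≤
      ENNReal.ofReal (K * ((N : ℝ) + 1) * (2 + max M 0 * C)) := by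
    intro r hr
    have hr' : r ∈ Icc 0 t₁ := ⟨hs.trans hr.1.le, hr.2.trans hs't⟩
    calc ∫⁻ z, F (z, r) ∂(localGibbsLaw σ a₀ u₀ θ₀ N Φ)
        = ∫⁻ z, ENNReal.ofReal (K * ∑ i, (1 + ‖(Φ.flow r z i).2‖ ^ 3)) ∂(localGibbsLaw σ a₀ u₀ θ₀ N Φ) := by
          refine lintegral_congr_ae ?_
          filter_upwards [hgood] with z hz
          simp only [hF, flowMod_of_mem Φ hz]
      _ ≤ ENNReal.ofReal (K * ((N : ℝ) + 1) * (2 + max M 0 * C)) :=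
          lintegral_cubicSum_le hσ2 ha hθ hu ha0 hθ0 Φ hK0 hC0 hKE (hECT r hr')
  calc ∫⁻ z, ENNReal.ofReal (∫ r in s..s', K * ∑ i, (1 + ‖(Φ.flow r z i).2‖ ^ 3)) ∂(localGibbsLaw σ a₀ u₀ θ₀ N Φ)
      = ∫⁻ z, (∫⁻ r in Ioc s s', F (z, r)) ∂(localGibbsLaw σ a₀ u₀ θ₀ N Φ) := lintegral_congr_ae h1
    _ = ∫⁻ r in Ioc s s', ∫⁻ z, F (z, r) ∂(localGibbsLaw σ a₀ u₀ θ₀ N Φ) := h2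
    _ ≤ ∫⁻ _r in Ioc s s', ENNReal.ofReal (K * ((N : ℝ) + 1) * (2 + max M 0 * C)) :=
        setLIntegral_mono' measurableSet_Ioc h3
    _ = ENNReal.ofReal ((s' - s) * (K * ((N : ℝ) + 1) * (2 + max M 0 * C))) := by
        rw [setLIntegral_const, Real.volume_Ioc, mul_comm, ← ENNReal.ofReal_mul (sub_nonneg.2 hss')]

end Summit.AtomisticToContinuum.HydrodynamicLimit.Theorems.HydroLimitInBandContinuity

end
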